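import Literature.Topology.FourManifolds.CollarTheorem
import Literature.Topology.FourManifolds.DiscTheoremSupport
import Literature.Topology.FourManifolds.InteriorDiffeoExtension
import Literature.Topology.FourManifolds.InteriorDiscs
import Literature.Topology.FourManifolds.InteriorConnected
import Literature.Topology.FourManifolds.BallRemovalCobordism
import Literature.Topology.FourManifolds.DisjunctionLemma
import Literature.AlgebraicTopology.Homotopy.CollarPush
import Mathlib.Topology.MetricSpace.HausdorffDimension
import Mathlib.Geometry.Manifold.PartitionOfUnity
import Mathlib.Topology.Homotopy.Basic
import Mathlib.Analysis.InnerProductSpace.Calculus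
import HarnessLib

/-!
# Maps from a compact manifold with boundary to the sphere of its dimension are null-homotopic

Topic `Literature/Topology/FourManifolds` (fact seat
`provefact-Literature.Topology.FourManifolds.HomotopySphere.boundsParallelizable_of_mem_signatureSet`).
Everything here is proved; there are no definitions and no named facts.

Kervaire–Milnor, *Groups of homotopy spheres I*, Ann. of Math. 77 (1963), proof of Lemma 3.4
(p. 509: a connected manifold with non-vacuous boundary is s-parallelizable iff parallelizable):
"This follows by a similar argument [to Lemma 3.5]. *The hypothesis on the manifold guarantees
that every map into a sphere of the same dimension is null-homotopic.*" This file proves that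
sentence, in the form consumed by `StableFramingLift.lean` / `HomotopySpheresSignatureProofs.lean`:

* `exists_homotopy_of_sphereValued` — for a compact connected `C^∞` manifold with boundary `W`
  of dimension `n + 2` (model `𝓡∂ (n + 2)`) with a boundary datum `b` (`Cobordism.lean`) whose
  boundary manifold is non-empty, every continuous `φ : W → F` with values in the unit sphere of
  a Euclidean space `F` of dimension `> n + 2` is homotopic through unit vectors to a constant.

Classically this is `Hᵏ(W; ℤ) = 0` plus Hopf's classification theorem, or obstruction theory on a
spine of dimension `< k`; neither is available. The proof given here is elementary and uses only
the collar and disc machinery of the tree: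

1. `φ` is approximated by a smooth `ψ` (Mathlib's partition-of-unity lemma
   `exists_contMDiffMap_forall_mem_convex_of_local_const`) and normalised; nowhere antipodal maps
   into the sphere are homotopic (`homotopic_of_forall_add_ne_zero`).
2. A collar `κ : ∂W × [0, 1] → W` (`BoundaryData.nonempty_collar_of_compactSpace`,
   `CollarTheorem.lean`) gives the pushes `push t ≃ id` onto the cores `W ∖ κ(∂W × [0, t))`
   (`CollarPush.lean`); the compact core at level `½` is covered by finitely many open discs
   `iⱼ(B)` of the interior (`exists_isSmoothEmbedding_of_isInteriorPoint`).
3. Each closed disc `iⱼ(B̄)` is moved into the open collar by a diffeomorphism `gⱼ` of `W`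
   (`exists_diffeomorph_image_closedBall_subset`: Milnor's homogeneity lemma with compact
   support in the connected boundaryless interior manifold, `DiscTheoremSupport.lean`,
   `InteriorConnected.lean`, ambient contraction of a disc, and extension by the identity,
   `InteriorDiffeoExtension.lean`), hence below some level `tⱼ < 1`
   (`exists_subset_below_of_isCompact`).
4. A point `y` of the sphere is chosen off the cones over the `ψ`-images of the finitely many
   transported levels `gⱼ⁻¹ κ(∂W × {tⱼ})` and `κ(∂W × {½})` — `C¹` images of the
   `(n+1)`-manifold `∂W`, of Hausdorff dimension `≤ n + 2 < dim F`
   (`dimH_cone_range_le_of_contMDiff`, from the tree's `dimH_range_le_finrank_of_contMDiff` of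
   `DisjunctionLemma.lean`, and Mathlib's `dense_compl_of_dimH_lt_finrank`).
5. Composing successively with the conjugated pushes `gⱼ⁻¹ ∘ push tⱼ ∘ gⱼ ≃ id` does not change
   the homotopy class and deletes from the fibre over `y` the transported open collar
   `gⱼ⁻¹ κ(∂W × [0, tⱼ)) ⊇ iⱼ(B)`, because that fibre never meets the transported level
   (`exists_homotopic_fibre_subset`); after the last step the fibre is empty, and a map into the
   sphere missing `y` is null-homotopic (`homotopic_const_of_forall_ne`).

## References

* M. Kervaire, J. Milnor, *Groups of homotopy spheres I*, Ann. of Math. (2) 77 (1963), 504–537,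
  Lemma 3.4 (p. 509). doi:10.2307/1970128 [KervaireMilnorAnnals1963]
* A. Hatcher, *Algebraic Topology*, CUP (2002), Prop. 3.42 (collars and cores). [HatcherAT2002]
* M. W. Hirsch, *Differential Topology*, GTM 33 (1976), Ch. 8 §3, Thm. 3.1. [HirschDT1976]
-/

open scoped Manifold ContDiff Topology RealInnerProductSpace NNReal
open Set Function Module Metric

noncomputable section

namespace Literature.Topology.FourManifolds

/-! ### Hausdorff dimension of `C¹` images -/

section DimH

variable {E F : Type*} [NormedAddCommGroup E] [NormedSpace ℝ E] [FiniteDimensional ℝ E]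
  [NormedAddCommGroup F] [NormedSpace ℝ F]

variable {H : Type*} [TopologicalSpace H] {I : ModelWithCorners ℝ E H}
  {N : Type*} [TopologicalSpace N] [ChartedSpace H N] [IsManifold I 1 N]
  [SecondCountableTopology N]

/-- The **cone** `{s • g a}` over the range of a `C¹` map from a `d`-dimensional manifold has
Hausdorff dimension at most `d + 1` (the tree's `dimH_range_le_finrank_of_contMDiff`,
`DisjunctionLemma.lean`, on `ℝ × N`). [folklore] -/
theorem dimH_cone_range_le_of_contMDiff {g : N → F} (hg : ContMDiff I 𝓘(ℝ, F) 1 g) :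
    dimH (range fun q : ℝ × N ↦ q.1 • g q.2) ≤ finrank ℝ E + 1 := by
  have h : ContMDiff (𝓘(ℝ, ℝ).prod I) 𝓘(ℝ, F) 1 fun q : ℝ × N ↦ q.1 • g q.2 :=
    contMDiff_fst.smul (hg.comp contMDiff_snd)
  refine (dimH_range_le_finrank_of_contMDiff h).trans ?_
  simp [finrank_prod, add_comm]

/-- A set of Hausdorff dimension less than the dimension of the (nontrivial) ambient space misses
some nonzero vector (its complement is dense, `dense_compl_of_dimH_lt_finrank`). [folklore] -/
theorem exists_ne_zero_notMem_of_dimH_lt [FiniteDimensional ℝ F] [Nontrivial F] {C : Set F}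
    (hC : dimH C < finrank ℝ F) : ∃ w ∉ C, w ≠ (0 : F) := by
  have hd : Dense Cᶜ := dense_compl_of_dimH_lt_finrank hC
  obtain ⟨z, hz⟩ := exists_ne (0 : F)
  obtain ⟨w, hw0, hwC⟩ := hd.inter_open_nonempty {0}ᶜ isOpen_compl_singleton ⟨z, hz⟩
  exact ⟨w, hwC, hw0⟩

end DimH

/-! ### Maps into the unit sphere: nowhere antipodal maps are homotopic -/

section SphereMaps

variable {X : Type*} [TopologicalSpace X] {F : Type*} [NormedAddCommGroup F]
  [InnerProductSpace ℝ F]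

/-- Convex combinations of two nowhere antipodal unit vectors do not vanish. [folklore] -/
theorem convexComb_ne_zero {u v : F} (hu : ‖u‖ = 1) (hv : ‖v‖ = 1) (huv : u + v ≠ 0) {t : ℝ}
    (ht0 : 0 ≤ t) (ht1 : t ≤ 1) : (1 - t) • u + t • v ≠ 0 := by
  intro h
  have hnorm : ‖(1 - t) • u‖ = ‖t • v‖ := by
    rw [eq_neg_of_add_eq_zero_left h, norm_neg]
  rw [norm_smul, norm_smul, hu, hv, mul_one, mul_one, Real.norm_of_nonneg (by linarith),
    Real.norm_of_nonneg ht0] at hnorm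
  have ht : t = 1 / 2 := by linarith
  subst ht
  apply huv
  have h2 : (1 / 2 : ℝ) • (u + v) = 0 := by
    rw [smul_add]; norm_num at h ⊢; exact h
  exact (smul_eq_zero.1 h2).resolve_left (by norm_num)

/-- Two unit vectors at distance `< 1` are not antipodal (indeed have positive inner product).
[folklore] -/
theorem add_ne_zero_of_norm_sub_lt_one {u v : F} (hu : ‖u‖ = 1) (huv : ‖u - v‖ < 1) :
    u + v ≠ 0 := by
  intro h
  have hv : v = -u := eq_neg_of_add_eq_zero_right h
  rw [hv, sub_neg_eq_add, ← two_smul ℝ u, norm_smul, hu, mul_one, Real.norm_two] at huv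
  norm_num at huv

/-- **Nowhere antipodal maps into the unit sphere are homotopic** (through the normalised
segment). [folklore] -/
theorem homotopic_of_forall_add_ne_zero (f g : C(X, sphere (0 : F) 1))
    (h : ∀ p, (f p : F) + g p ≠ 0) : f.Homotopic g := by
  set v : unitInterval × X → F := fun q ↦ (1 - (q.1 : ℝ)) • (f q.2 : F) + (q.1 : ℝ) • g q.2
    with hv
  have hvc : Continuous v := by
    refine ((continuous_const.sub (continuous_subtype_val.comp continuous_fst)).smul
      (continuous_subtype_val.comp (f.continuous.comp continuous_snd))).add
      ((continuous_subtype_val.comp continuous_fst).smul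
        (continuous_subtype_val.comp (g.continuous.comp continuous_snd)))
  have hv0 : ∀ q, v q ≠ 0 := fun q ↦
    convexComb_ne_zero (norm_eq_of_mem_sphere (f q.2)) (norm_eq_of_mem_sphere (g q.2)) (h q.2)
      q.1.2.1 q.1.2.2
  refine ⟨{ toFun := fun q ↦ ⟨‖v q‖⁻¹ • v q, mem_sphere_zero_iff_norm.2
              (norm_smul_inv_norm (hv0 q))⟩
            continuous_toFun := ?_
            map_zero_left := fun p ↦ ?_
            map_one_left := fun p ↦ ?_ }⟩
  · exact ((hvc.norm.inv₀ fun q ↦ norm_ne_zero_iff.2 (hv0 q)).smul hvc).subtype_mk _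
  · ext
    simp [hv, norm_eq_of_mem_sphere (f p)]
  · ext
    simp [hv, norm_eq_of_mem_sphere (g p)]

/-- A map into the unit sphere which misses a point `y` is homotopic to the constant map at
`-y`. [folklore] -/
theorem homotopic_const_of_forall_ne (f : C(X, sphere (0 : F) 1)) (y : sphere (0 : F) 1)
    (h : ∀ p, f p ≠ y) : f.Homotopic (ContinuousMap.const X (-y)) := by
  refine homotopic_of_forall_add_ne_zero f _ fun p hp ↦ h p (Subtype.ext ?_)
  have : (f p : F) + -(y : F) = 0 := hp
  exact eq_of_sub_eq_zero (by rwa [← sub_eq_add_neg] at this)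

end SphereMaps

/-! ### The collar push as a homotopy, and the fibre bookkeeping of the iteration -/

section Push

open Literature.AlgebraicTopology.Homotopy

variable {W : Type*} [TopologicalSpace W] {A : Type*} [TopologicalSpace A] [Nonempty A]
  (κ : BoundaryCollar W A)

/-- **The push to a level is homotopic to the identity** (`s ↦ push (min t (1 - s))`; Hatcher
2002, Prop. 3.42). [folklore] -/
theorem homotopic_push_id (t : unitInterval) :
    (⟨κ.push t, κ.continuous_push_left t⟩ : C(W, W)).Homotopic (ContinuousMap.id W) := by
  refine ⟨{ toFun := fun q ↦ κ.push (BoundaryCollar.lev t q.1) q.2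
            continuous_toFun := κ.continuous_push.comp
              (((BoundaryCollar.continuous_lev t).comp continuous_fst).prodMk continuous_snd)
            map_zero_left := fun w ↦ ?_
            map_one_left := fun w ↦ ?_ }⟩
  · simp [BoundaryCollar.lev, min_eq_left unitInterval.le_one']
  · simp [BoundaryCollar.lev]

/-- The push either fixes a point or moves it to the level `t` of the collar. [folklore] -/
theorem push_eq_self_or_mem_level (t : unitInterval) (w : W) :
    κ.push t w = w ∨ κ.push t w ∈ κ.collar '' {q | q.2 = t} := by
  by_cases hw : w ∈ range κ.collar
  · obtain ⟨q, rfl⟩ := hw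
    rw [κ.push_collar]
    rcases le_total q.2 t with hle | hle
    · exact Or.inr ⟨(q.1, t), rfl, by rw [max_eq_right hle]⟩
    · exact Or.inl (by rw [max_eq_left hle])
  · exact Or.inl (κ.push_of_not_mem_range t hw)

/-- A point fixed by the push to level `t` is not below level `t`. [folklore] -/
theorem not_mem_below_of_push_eq (t : unitInterval) {w : W} (h : κ.push t w = w) :
    w ∉ κ.below t := by
  have := κ.push_mem_core t w
  rw [h] at this
  exact this

/-- **One step of the iteration.** For a homeomorphism `g` of `W` and a level `t`, the
conjugated push `P = g⁻¹ ∘ push t ∘ g` is homotopic to the identity, so `f ∘ P ≃ f`; and if the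
fibre of `f` over `y` avoids the transported level `g⁻¹ (κ (A × {t}))`, then the fibre of `f ∘ P`
over `y` is that of `f` with the transported open collar `g⁻¹ (κ (A × [0, t)))` removed.
[folklore] -/
theorem exists_homotopic_fibre_subset {Y : Type*} [TopologicalSpace Y] (y : Y) :
    ∀ (L : List ((W ≃ₜ W) × unitInterval)) (f : C(W, Y)),
      (∀ gt ∈ L, ∀ p, f p = y → gt.1 p ∉ κ.collar '' {q | q.2 = gt.2}) →
      ∃ f' : C(W, Y), f'.Homotopic f ∧
        ∀ p, f' p = y → f p = y ∧ ∀ gt ∈ L, gt.1 p ∉ κ.below gt.2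
  | [], f, _ => ⟨f, ContinuousMap.Homotopic.refl f, fun p hp ↦ ⟨hp, fun gt hgt ↦ by simp at hgt⟩⟩
  | (g, t) :: L, f, hcut => by
    -- the conjugated push and the new map
    set P : C(W, W) := (g.symm : C(W, W)).comp
      ((⟨κ.push t, κ.continuous_push_left t⟩ : C(W, W)).comp (g : C(W, W))) with hP
    have hPid : P.Homotopic (ContinuousMap.id W) := by
      have h := ((ContinuousMap.Homotopic.refl (g.symm : C(W, W))).comp
        ((homotopic_push_id κ t).comp (ContinuousMap.Homotopic.refl (g : C(W, W)))))
      have hid : (g.symm : C(W, W)).comp ((ContinuousMap.id W).comp (g : C(W, W))) =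
          ContinuousMap.id W := by
        ext w; simp
      rwa [hid] at h
    set f₁ : C(W, Y) := f.comp P with hf₁
    have hf₁f : f₁.Homotopic f := by
      have h := (ContinuousMap.Homotopic.refl f).comp hPid
      rwa [ContinuousMap.comp_id] at h
    -- fibre of `f₁`
    have hfib : ∀ p, f₁ p = y → P p = p ∧ f p = y := by
      intro p hp
      have hp' : f (P p) = y := hp
      have hPp : P p = p := by
        rcases push_eq_self_or_mem_level κ t (g p) with h | h
        · show g.symm (κ.push t (g p)) = p
          rw [h, Homeomorph.symm_apply_apply]
        · exfalso
          refine hcut (g, t) (by simp) (P p) hp' ?_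
          show g (g.symm (κ.push t (g p))) ∈ _
          rwa [Homeomorph.apply_symm_apply]
      exact ⟨hPp, by rwa [hPp] at hp'⟩
    -- induction
    have hcut₁ : ∀ gt ∈ L, ∀ p, f₁ p = y → gt.1 p ∉ κ.collar '' {q | q.2 = gt.2} :=
      fun gt hgt p hp ↦ hcut gt (by simp [hgt]) p (hfib p hp).2
    obtain ⟨f', hf'f₁, hf'⟩ := exists_homotopic_fibre_subset y L f₁ hcut₁
    refine ⟨f', hf'f₁.trans hf₁f, fun p hp ↦ ?_⟩
    obtain ⟨hp₁, hL⟩ := hf' p hp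
    obtain ⟨hPp, hfp⟩ := hfib p hp₁
    refine ⟨hfp, fun gt hgt ↦ ?_⟩
    simp only [List.mem_cons] at hgt
    rcases hgt with rfl | hgt
    · -- `P p = p` means `push t (g p) = g p`, so `g p ∉ below t`
      have h1 : κ.push t (g p) = g p := by
        have := congrArg g hPp
        simpa [hP] using this
      exact not_mem_below_of_push_eq κ t h1
    · exact hL gt hgt

end Push

/-! ### Compact pieces of the interior can be moved into the open collar -/

section Geometry

universe u

variable {n : ℕ} {W : Type u} [TopologicalSpace W] [T2Space W]
  [ChartedSpace (EuclideanHalfSpace (n + 1 + 1)) W] [IsManifold (𝓡∂ (n + 1 + 1)) ∞ W]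

/-- **A closed disc in the interior of a connected manifold with boundary can be moved into any
non-empty open subset of the interior by a diffeomorphism**: contract the disc ambiently
(`exists_diffeomorph_apply_disc_eq_disc_smul_cs`) after carrying its centre into the open set
by a compactly supported diffeomorphism of the (connected, boundaryless) interior manifold
(Milnor's homogeneity lemma, `exists_diffeomorph_apply_eq_forall_isOrientationPreserving_cs`),
and extend by the identity over the boundary (`InteriorManifold.exists_diffeomorph_extend`).
(Hirsch, *Differential Topology* (1976), Ch. 8 §3, Thm. 3.1 with "compact support".)
[cite: HirschDT1976, Ch. 8 §3, Thm. 3.1] -/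
theorem exists_diffeomorph_image_closedBall_subset [ConnectedSpace W]
    {i : EuclideanSpace ℝ (Fin (n + 1 + 1)) → W}
    (hi : Manifold.IsSmoothEmbedding (𝓡 (n + 1 + 1)) (𝓡∂ (n + 1 + 1)) ∞ i) {U : Set W}
    (hU : IsOpen U) (hUint : U ⊆ (𝓡∂ (n + 1 + 1)).interior W) (hUne : U.Nonempty) :
    ∃ g : W ≃ₘ^∞⟮𝓡∂ (n + 1 + 1), 𝓡∂ (n + 1 + 1)⟯ W, g '' (i '' closedBall 0 1) ⊆ U := by
  have hint := isInteriorPoint_of_isSmoothEmbedding_disc hi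
  set j : EuclideanSpace ℝ (Fin (n + 1 + 1)) → InteriorManifold (𝓡∂ (n + 1 + 1)) W :=
    InteriorManifold.lift i hint with hj
  have hjemb : Manifold.IsSmoothEmbedding (𝓡 (n + 1 + 1)) (𝓡 (n + 1 + 1)) ∞ j :=
    InteriorManifold.isSmoothEmbedding_lift_disc hi
  have hjc : Continuous j := hjemb.contMDiff.continuous
  obtain ⟨q₀, hq₀⟩ := hUne
  set x₀ : InteriorManifold (𝓡∂ (n + 1 + 1)) W := ⟨q₀, hUint hq₀⟩ with hx₀
  obtain ⟨h, hhx, -, hhcs⟩ :=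
    exists_diffeomorph_apply_eq_forall_isOrientationPreserving_cs (n := n + 1 + 1) (j 0) x₀
  -- a radius `r` with `h (j (B(0, r))) ⊆ U`
  have hopen : IsOpen (j ⁻¹' (h ⁻¹' (InteriorManifold.val ⁻¹' U))) :=
    ((hU.preimage InteriorManifold.continuous_val).preimage h.continuous).preimage hjc
  have h0mem :
      (0 : EuclideanSpace ℝ (Fin (n + 1 + 1))) ∈ j ⁻¹' (h ⁻¹' (InteriorManifold.val ⁻¹' U)) := by
    show (h (j 0)).val ∈ U
    rw [hhx]
    exact hq₀
  obtain ⟨r, hr, hball⟩ := Metric.isOpen_iff.1 hopen 0 h0mem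
  obtain ⟨K, -, hKcs, hK⟩ := exists_diffeomorph_apply_disc_eq_disc_smul_cs (n := n + 1 + 1)
    (by omega) hjemb (half_pos hr)
  -- the composite `h ∘ K`, extended by the identity to `W`
  have hGcs : Function.HasCompactFixedSupport (K.trans h) := by
    rw [Diffeomorph.coe_trans]
    exact hhcs.comp hKcs
  obtain ⟨K₀, hK₀, hGK₀⟩ := exists_isCompact_forall_eq_self_of_hasCompactFixedSupport hGcs
  obtain ⟨g, hgval, -⟩ := InteriorManifold.exists_diffeomorph_extend (K.trans h) hK₀ hGK₀
  refine ⟨g, ?_⟩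
  rintro _ ⟨_, ⟨y, hy, rfl⟩, rfl⟩
  rw [mem_closedBall_zero_iff] at hy
  have h1 : g (i y) = (h (K (j y))).val := hgval (j y)
  rw [h1, hK y hy]
  have hmem : (r / 2) • y ∈ j ⁻¹' (h ⁻¹' (InteriorManifold.val ⁻¹' U)) := by
    refine hball (mem_ball_zero_iff.2 ?_)
    rw [norm_smul, Real.norm_of_nonneg (half_pos hr).le]
    nlinarith [norm_nonneg y]
  exact hmem

variable {A : Type*} [TopologicalSpace A] [Nonempty A]

omit [T2Space W] in
open Literature.AlgebraicTopology.Homotopy in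
/-- A compact set inside the half-open collar `κ (A × [0, 1))` lies below some level `t < 1`.
[folklore] -/
theorem exists_subset_below_of_isCompact (κ : BoundaryCollar W A) {K : Set W} (hK : IsCompact K)
    (hK1 : K ⊆ κ.below 1) : ∃ t : unitInterval, K ⊆ κ.below t := by
  rcases K.eq_empty_or_nonempty with rfl | hKne
  · exact ⟨0, empty_subset _⟩
  have hKr : K ⊆ range κ.collar := hK1.trans (κ.below_subset_range 1)
  set σ : W → ℝ := fun w ↦ ((κ.inv w).2 : ℝ) with hσ
  have hσc : ContinuousOn σ K :=
    ((continuous_subtype_val.comp continuous_snd).comp_continuousOn κ.continuousOn_inv).mono hKr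
  obtain ⟨w₀, hw₀K, hw₀⟩ := hK.exists_isMaxOn hKne hσc
  obtain ⟨q₀, hq₀, hq₀w⟩ := hK1 hw₀K
  have hs1 : σ w₀ < 1 := by
    simp only [hσ, ← hq₀w, BoundaryCollar.inv_collar]
    exact hq₀
  have hs0 : 0 ≤ σ w₀ := (κ.inv w₀).2.2.1
  refine ⟨⟨(σ w₀ + 1) / 2, ⟨by linarith, by linarith⟩⟩, fun w hw ↦ ?_⟩
  obtain ⟨q, rfl⟩ := hKr hw
  refine ⟨q, ?_, rfl⟩
  have hle : σ (κ.collar q) ≤ σ w₀ := hw₀ hw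
  simp only [hσ, BoundaryCollar.inv_collar] at hle
  show (q.2 : ℝ) < (σ w₀ + 1) / 2
  linarith

end Geometry

/-! ### Maps to the sphere of the same dimension are null-homotopic -/

section Main

universe u

open Literature.AlgebraicTopology.Homotopy

variable {n : ℕ} {W : Type u} [TopologicalSpace W] [T2Space W] [CompactSpace W]
  [ChartedSpace (EuclideanHalfSpace (n + 1 + 1)) W] [IsManifold (𝓡∂ (n + 1 + 1)) ∞ W]
  [ConnectedSpace W]
  {F : Type*} [NormedAddCommGroup F] [InnerProductSpace ℝ F] [FiniteDimensional ℝ F]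

/-- **Every map from a compact connected manifold with non-empty boundary to a sphere of at
least its dimension is null-homotopic** — the topological input of Kervaire–Milnor's Lemma 3.4
(*Groups of homotopy spheres I* (1963), p. 509: "The hypothesis on the manifold guarantees that
every map into a sphere of the same dimension is null-homotopic"). Here `W` is a compact
connected `C^∞` `(n+2)`-manifold with boundary carrying a boundary datum `b` with non-empty
(closed) boundary manifold, `φ : W → F` is continuous with values in the unit sphere of a
Euclidean space of dimension `> n + 2`, and the conclusion is a homotopy through unit vectors
from the constant map `e` to `φ`.

Proof (elementary, in place of obstruction theory or Hopf's theorem): approximate `φ` by a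
smooth `ψ` (partition of unity) and normalise; take a collar `κ` of `∂W` (`CollarTheorem.lean`)
and cover the compact core `W ∖ κ(∂W × [0, ½))` by finitely many open discs `iⱼ(B)` in the
interior; move each closed disc `iⱼ(B̄)` into the open collar by a diffeomorphism `gⱼ`
(`exists_diffeomorph_image_closedBall_subset`), below a level `tⱼ < 1`; choose the target value
`y` of the sphere off the cones over the `ψ`-images of the finitely many transported collar
levels `gⱼ⁻¹ κ(∂W × {tⱼ})` (images of the `(n+1)`-manifold `∂W`, Hausdorff dimension `≤ n + 2 <
dim F`, `dimH_cone_range_le_of_contMDiff`); then composing successively with the conjugated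
collar pushes `gⱼ⁻¹ ∘ push tⱼ ∘ gⱼ ≃ id` (`exists_homotopic_fibre_subset`) removes the fibre over
`y` disc by disc, so the final map misses `y` and is null-homotopic
(`homotopic_const_of_forall_ne`). [cite: KervaireMilnorAnnals1963, proof of Lemma 3.4 (p. 509)] -/
theorem exists_homotopy_of_sphereValued (b : BoundaryData (𝓡∂ (n + 1 + 1)) W (𝓡 (n + 1)))
    [Nonempty b.carrier] [CompactSpace b.carrier] (hdim : n + 1 + 1 < finrank ℝ F)
    (φ : W → F) (hφ : Continuous φ) (hφ1 : ∀ p, ‖φ p‖ = 1) {e : F} (he : ‖e‖ = 1) :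
    ∃ G : unitInterval × W → F, Continuous G ∧ (∀ q, ‖G q‖ = 1) ∧ (∀ p, G (0, p) = e) ∧
      ∀ p, G (1, p) = φ p := by
  classical
  haveI : SecondCountableTopology b.carrier :=
    ChartedSpace.secondCountable_of_sigmaCompact (EuclideanSpace ℝ (Fin (n + 1))) b.carrier
  have hF : Nontrivial F := Module.nontrivial_of_finrank_pos (R := ℝ) (by omega)
  -- 0. the collar
  obtain ⟨col⟩ := BoundaryData.nonempty_collar_of_compactSpace n W b
  let κ : BoundaryCollar W b.carrier :=
    ⟨col.toFun, col.continuous.isClosedEmbedding col.injective, col.isOpen_image⟩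
  have hκcol : ∀ q, κ.collar q = col q := fun _ ↦ rfl
  have hκint : κ.interior = (𝓡∂ (n + 1 + 1)).interior W := by
    rw [BoundaryCollar.interior, ← ModelWithCorners.compl_boundary, ← b.range_incl]
    congr 1
    ext w
    constructor
    · rintro ⟨a, rfl⟩; exact ⟨a, (col.apply_bot a).symm⟩
    · rintro ⟨a, rfl⟩; exact ⟨a, col.apply_bot a⟩
  -- 1. smooth approximation `ψ` of `φ`, and its normalisation `f`
  obtain ⟨ψ, hψ⟩ := exists_contMDiffMap_forall_mem_convex_of_local_const (I := 𝓡∂ (n + 1 + 1))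
    (n := (⊤ : ℕ∞)) (t := fun p ↦ ball (φ p) (1 / 2)) (fun p ↦ convex_ball _ _) (fun p ↦
      ⟨φ p, (hφ.continuousAt (x := p)).eventually_mem (ball_mem_nhds (φ p) one_half_pos) |>.mono
        fun q hq ↦ by rw [mem_ball, dist_comm]; exact hq⟩)
  have hψφ : ∀ p, ‖ψ p - φ p‖ < 1 / 2 := fun p ↦ by rw [← dist_eq_norm]; exact hψ p
  have hψ0 : ∀ p, ψ p ≠ 0 := fun p h0 ↦ by
    have := hψφ p
    rw [h0, zero_sub, norm_neg, hφ1] at this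
    norm_num at this
  set f : W → F := fun p ↦ ‖ψ p‖⁻¹ • ψ p with hf
  have hψc : Continuous ψ := ψ.contMDiff.continuous
  have hfc : Continuous f := (hψc.norm.inv₀ fun p ↦ norm_ne_zero_iff.2 (hψ0 p)).smul hψc
  have hf1 : ∀ p, ‖f p‖ = 1 := fun p ↦ norm_smul_inv_norm (hψ0 p)
  have hfφ : ∀ p, f p + φ p ≠ 0 := by
    intro p
    rw [add_comm]
    refine add_ne_zero_of_norm_sub_lt_one (hφ1 p) ?_
    -- `‖φ - f‖ ≤ ‖φ - ψ‖ + ‖ψ - f‖ = ‖φ - ψ‖ + |‖ψ‖ - 1| ≤ 2‖φ - ψ‖ < 1`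
    have h1 : ‖ψ p - f p‖ = |‖ψ p‖ - 1| := by
      have : ψ p - f p = (‖ψ p‖ - 1) • f p := by
        rw [sub_smul, one_smul, hf]
        simp only
        rw [smul_smul, mul_inv_cancel₀ (norm_ne_zero_iff.2 (hψ0 p)), one_smul]
      rw [this, norm_smul, hf1, mul_one, Real.norm_eq_abs]
    have h2 : |‖ψ p‖ - 1| ≤ ‖ψ p - φ p‖ := by
      rw [← hφ1 p]; exact abs_norm_sub_norm_le _ _
    calc ‖φ p - f p‖ ≤ ‖φ p - ψ p‖ + ‖ψ p - f p‖ := norm_sub_le_norm_sub_add_norm_sub _ _ _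
      _ < 1 / 2 + 1 / 2 := by
        rw [h1, norm_sub_rev]
        exact add_lt_add_of_lt_of_le (hψφ p) ((h2.trans_lt (hψφ p)).le)
      _ = 1 := by norm_num
  -- 2. the level `t₀ = 1/2`, the core and its cover by discs
  set t₀ : unitInterval := ⟨1 / 2, ⟨by norm_num, by norm_num⟩⟩ with ht₀def
  have ht₀ : (0 : unitInterval) < t₀ := Subtype.mk_lt_mk.2 (by norm_num)
  have ht₀1 : t₀ < 1 := Subtype.mk_lt_mk.2 (by norm_num)
  have hcore : κ.core t₀ ⊆ (𝓡∂ (n + 1 + 1)).interior W :=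
    (κ.core_subset_interior ht₀).trans hκint.subset
  have hdisc : ∀ p : κ.core t₀, ∃ i : EuclideanSpace ℝ (Fin (n + 1 + 1)) → W,
      Manifold.IsSmoothEmbedding (𝓡 (n + 1 + 1)) (𝓡∂ (n + 1 + 1)) ∞ i ∧ i 0 = p := by
    intro p
    obtain ⟨i, hi, -, -, hi0⟩ := exists_isSmoothEmbedding_of_isInteriorPoint (hcore p.2)
    exact ⟨i, hi, hi0⟩
  choose i hi hi0 using hdisc
  obtain ⟨T, hT⟩ := (κ.isCompact_core t₀).elim_finite_subcover (fun p ↦ i p '' ball 0 1)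
    (fun p ↦ isOpenMap_disc (hi p) _ isOpen_ball)
    (fun w hw ↦ mem_iUnion.2 ⟨⟨w, hw⟩, 0, mem_ball_self one_pos, hi0 _⟩)
  -- 3. the diffeomorphisms moving the closed discs into the open collar, and their levels
  have hstrip : κ.strip 1 = κ.interior ∩ κ.below 1 := κ.strip_eq 1
  have hstrip_open : IsOpen (κ.strip 1) := by
    rw [hstrip]; exact κ.isOpen_interior.inter (κ.isOpen_below 1)
  have hstrip_int : κ.strip 1 ⊆ (𝓡∂ (n + 1 + 1)).interior W := by
    rw [hstrip, hκint]; exact inter_subset_left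
  obtain ⟨a₀⟩ := (inferInstance : Nonempty b.carrier)
  have hstrip_ne : (κ.strip 1).Nonempty := ⟨κ.collar (a₀, t₀), (a₀, t₀), ⟨ht₀, ht₀1⟩, rfl⟩
  have hgex : ∀ p : κ.core t₀, ∃ g : W ≃ₘ^∞⟮𝓡∂ (n + 1 + 1), 𝓡∂ (n + 1 + 1)⟯ W,
      g '' (i p '' closedBall 0 1) ⊆ κ.strip 1 := fun p ↦
    exists_diffeomorph_image_closedBall_subset (hi p) hstrip_open hstrip_int hstrip_ne
  choose g hg using hgex
  have htex : ∀ p : κ.core t₀, ∃ t : unitInterval, g p '' (i p '' closedBall 0 1) ⊆ κ.below t :=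
    fun p ↦ exists_subset_below_of_isCompact κ
      (((isCompact_closedBall _ _).image (hi p).contMDiff.continuous).image (g p).continuous)
      ((hg p).trans (by rw [hstrip]; exact inter_subset_right))
  choose t ht using htex
  -- 4. the list of steps: the plain push to `t₀`, then the conjugated pushes
  set L : List ((W ≃ₘ^∞⟮𝓡∂ (n + 1 + 1), 𝓡∂ (n + 1 + 1)⟯ W) × unitInterval) :=
    (Diffeomorph.refl _ W _, t₀) :: (T.toList.map fun p ↦ (g p, t p)) with hL
  -- every point of `W` is below the level of some step
  have hcover : ∀ w : W, ∃ gt ∈ L, gt.1 w ∈ κ.below gt.2 := by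
    intro w
    by_cases hw : w ∈ κ.below t₀
    · exact ⟨(Diffeomorph.refl _ W _, t₀), by simp [hL], hw⟩
    · obtain ⟨p, hpT, hwp⟩ := mem_iUnion₂.1 (hT hw)
      refine ⟨(g p, t p), by simp [hL]; exact Or.inr ⟨p.1, p.2, hpT, rfl, rfl⟩, ht p ?_⟩
      exact ⟨w, image_mono ball_subset_closedBall hwp, rfl⟩
  -- 5. the cones over the `ψ`-images of the transported levels, and the choice of `y`
  set cone : (W ≃ₘ^∞⟮𝓡∂ (n + 1 + 1), 𝓡∂ (n + 1 + 1)⟯ W) × unitInterval → Set F :=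
    fun gt ↦ range fun q : ℝ × b.carrier ↦ q.1 • ψ (gt.1.symm (col (q.2, gt.2))) with hcone
  have hconedim : ∀ gt, dimH (cone gt) ≤ (n + 1 : ℕ) + 1 := by
    intro gt
    have hsm : ContMDiff (𝓡 (n + 1)) 𝓘(ℝ, F) 1 fun a : b.carrier ↦ ψ (gt.1.symm (col (a, gt.2))) :=
      ((ψ.contMDiff.comp gt.1.symm.contMDiff).comp
        (col.isSmoothEmbedding.contMDiff.comp (contMDiff_id.prodMk contMDiff_const))).of_le
          (by exact_mod_cast le_top)
    have h := dimH_cone_range_le_of_contMDiff hsm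
    rwa [finrank_euclideanSpace_fin] at h
  set C : Set F := (⋃ gt ∈ {gt | gt ∈ L}, cone gt) ∪ range fun s : ℝ ↦ s • e with hC
  have hCdim : dimH C < finrank ℝ F := by
    rw [hC, dimH_union, dimH_bUnion (List.finite_toSet L).countable]
    refine max_lt (lt_of_le_of_lt (iSup₂_le fun gt _ ↦ hconedim gt) ?_) ?_
    · exact_mod_cast hdim
    · refine lt_of_le_of_lt (ContDiff.dimH_range_le (contDiff_id.smul contDiff_const)) ?_
      rw [Module.finrank_self]
      exact_mod_cast (show 1 < finrank ℝ F by omega)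
  obtain ⟨w, hwC, hw0⟩ := exists_ne_zero_notMem_of_dimH_lt hCdim
  set yv : F := ‖w‖⁻¹ • w with hyv
  have hyv1 : ‖yv‖ = 1 := norm_smul_inv_norm hw0
  have hwy : w = ‖w‖ • yv := by
    rw [hyv, smul_smul, mul_inv_cancel₀ (norm_ne_zero_iff.2 hw0), one_smul]
  have hye : yv ≠ e := by
    intro h
    refine hwC (Or.inr ⟨‖w‖, ?_⟩)
    show ‖w‖ • e = w
    rw [← h, ← hwy]
  -- 6. the cut condition: the fibre of `f` over `y` avoids every transported level
  set fS : C(W, sphere (0 : F) 1) :=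
    ⟨fun p ↦ ⟨f p, mem_sphere_zero_iff_norm.2 (hf1 p)⟩, hfc.subtype_mk _⟩ with hfS
  set φS : C(W, sphere (0 : F) 1) :=
    ⟨fun p ↦ ⟨φ p, mem_sphere_zero_iff_norm.2 (hφ1 p)⟩, hφ.subtype_mk _⟩ with hφS
  set y : sphere (0 : F) 1 := ⟨yv, mem_sphere_zero_iff_norm.2 hyv1⟩ with hy
  set LH : List ((W ≃ₜ W) × unitInterval) := L.map fun gt ↦ (gt.1.toHomeomorph, gt.2) with hLH
  have hcut : ∀ gt ∈ LH, ∀ p, fS p = y → gt.1 p ∉ κ.collar '' {q | q.2 = gt.2} := by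
    intro gt hgt p hp hlev
    obtain ⟨gt', hgt', rfl⟩ := List.mem_map.1 hgt
    obtain ⟨q, hq, hqp⟩ := hlev
    -- `p = gt'.1.symm (col (q.1, gt'.2))` and `w = ‖w‖ ‖ψ p‖⁻¹ • ψ p ∈ cone gt'`
    have hp' : (f p : F) = yv := by
      have := congrArg (fun z : sphere (0 : F) 1 ↦ (z : F)) hp
      simpa [hfS, hy] using this
    have hpq : p = gt'.1.symm (col (q.1, gt'.2)) := by
      have hq2 : q.2 = gt'.2 := by simpa using hq
      have h1 : gt'.1 p = col (q.1, gt'.2) := by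
        rw [← hq2]
        exact hqp.symm
      rw [← h1, Diffeomorph.symm_apply_apply]
    refine hwC (Or.inl (mem_iUnion₂.2 ⟨gt', hgt', (‖w‖ * ‖ψ p‖⁻¹, q.1), ?_⟩))
    show (‖w‖ * ‖ψ p‖⁻¹) • ψ (gt'.1.symm (col (q.1, gt'.2))) = w
    rw [← hpq, mul_smul]
    change ‖w‖ • f p = w
    rw [hp', ← hwy]
  -- 7. iterate the pushes: a map homotopic to `f` which misses `y`
  obtain ⟨f', hf'f, hf'⟩ := exists_homotopic_fibre_subset κ y LH fS hcut
  have hmiss : ∀ p, f' p ≠ y := by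
    intro p hp
    obtain ⟨-, hall⟩ := hf' p hp
    obtain ⟨gt, hgt, hw⟩ := hcover p
    exact hall (gt.1.toHomeomorph, gt.2) (List.mem_map.2 ⟨gt, hgt, rfl⟩) hw
  -- 8. assemble the homotopies: `e ≃ -y ≃ f' ≃ f ≃ φ`
  set eS : sphere (0 : F) 1 := ⟨e, mem_sphere_zero_iff_norm.2 he⟩ with heS
  have h1 : (ContinuousMap.const W eS).Homotopic (ContinuousMap.const W (-y)) :=
    homotopic_of_forall_add_ne_zero _ _ fun p h ↦ hye (by
      have : (e : F) + -yv = 0 := h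
      rw [add_neg_eq_zero] at this
      exact this.symm)
  have h2 : (ContinuousMap.const W (-y)).Homotopic f' :=
    (homotopic_const_of_forall_ne f' y hmiss).symm
  have h3 : fS.Homotopic φS := homotopic_of_forall_add_ne_zero _ _ fun p ↦ hfφ p
  obtain ⟨H⟩ := ((h1.trans h2).trans hf'f).trans h3
  refine ⟨fun q ↦ (H q : F), continuous_subtype_val.comp H.continuous,
    fun q ↦ norm_eq_of_mem_sphere (H q), fun p ↦ ?_, fun p ↦ ?_⟩
  · show (H (0, p) : F) = e
    rw [H.apply_zero]; rfl
  · show (H (1, p) : F) = φ p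
    rw [H.apply_one]; rfl

end Main

end Literature.Topology.FourManifolds
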